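import Summits.MatrixMultiplication.MatrixMultiplication.Theorems.ObstructionDescentUniversalOccurrenceLetterExchange

set_option linter.dupNamespace false
set_option autoImplicit false

/-!
# Universal occurrence — the three-column law: `¬UOCC(8, 6)` and `¬UOCC(11, 8)` (route `ObstructionDescent`, kernel K16, part 2 of 3)

Support file for the crux `NoOccurrenceObstruction` (`P_O`, item `stmt-MatrixMultiplication-29040`) of
`Summit.MatrixMultiplication.MatrixMultiplication.Theses.ObstructionDescent`; sequel of `…UniversalOccurrenceKronecker` (K-gen 32:
`UOCC(m,N) ⟺ K(N,N,N) ⊆ S(⟨m⟩)`), `…HookBand` (K10: `u(N) ≥ 3⌊(N−1)/2⌋+1`), `…KoszulFive` (K15: `u(N) ≥ 8` for `N ≥ 5`) and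
`…Six` (K12: `u(6) ≤ 14`).  `UOCC(m, N)` is spelled out literally in every statement (no `def`): every partition triple occurring
in a tensor power of ANY complex tensor on `≤ N` letters occurs in the same power of the unit tensor `⟨m⟩`; `u(N)` = the least such `m`.

## The law (general and def-free; §1–§3 of the mechanism are in `…UniversalOccurrenceLetterExchange`)

**Three-column law** (`isotypicSum_kroneckerPow_unitTensor_eq_zero_of_parts_le_three`).  *Let `λ = (λ⁰, λ¹, λ²) ⊢ d` be partitions
all of whose parts are `≤ 3` (Young diagrams with at most three columns).  If `d ≥ 2m + 2` then `λ` does not occur in `⟨m⟩^{⊗d}`* —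
every highest-weight vector of weight `λ` in `ℂ[ℂᵐ ⊗ ℂᵐ ⊗ ℂᵐ]_d` vanishes on the tensors of border rank `≤ m` (closure statement,
`S(⟨m⟩)`, not merely the orbit).  Proof = the tree's road for BI 2011 Lemma 6.1 (`UnitTensorSLObstructionsProofs`) with a new
support analysis: a non-zero pairing gives, after expanding the three highest-weight vectors in polytabloids
(`exists_sum_smul_polytabloid_eq`) and the power of `(A⊗B⊗C)·⟨m⟩` over label maps `I : [d] → [m]` (`pairing_unitTensor_eq_sum`),
a non-zero term `⟨⊗a_I, e_{T₁}⟩⟨⊗b_I, e_{T₂}⟩⟨⊗c_I, e_{T₃}⟩`; such an `I` is injective on the columns of each tableau, so every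
letter has `≤ 3` positions (three columns), and since the fibre sizes sum to `d ≥ 2m + 2` TWO letters `x ≠ y` have exactly three
positions — one in each column of EACH tableau (`exists_two_tripleLetters_of_term_ne_zero`).  Exchanging `x ↔ y` is then three
same-column transpositions in each of the three tableaux (`swap_comp_eq_comp_swap_three`, `threeCol_pairing_letterSwap`): sign
`(−1)⁹ = −1`, and the letter exchange is a sign-reversing involution on the support (`sum_eq_zero_of_letterSwap_invol`,
`threeCol_tripleSum_eq_zero`).  The mechanism — "exchanging two symbols is one transposition per slice" — is that of
BI 2011 Lemma 6.1, of BI 2017 Prop. 5.22(2) (`F_n(⟨n²⟩) = 0` for odd `n`) and of Amanov–Yeliussizov 2022, Lemma 7.11 / Cor. 7.12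
(every invariant of degree `kn`, `k` odd, vanishes AT the unit tensor `I_n`); what is added here is the counting step, which moves
the statement from the point `⟨n⟩` to the whole secant variety `σ_m`, `m ≤ (d − 2)/2`, and from invariants to all three-column types.

## The cells (in `…UniversalOccurrenceThreeColumnsCells`)

`g((3⁶)³) = g((3⁸)³) = 1` put the cube types into `K(6,6,6)` and `K(8,8,8)` while the law kills them on `⟨8⟩^{⊗18}` and
`⟨11⟩^{⊗24}`: `¬UOCC(8,6)` and `¬UOCC(11,8)`, i.e. `u(N) ≥ 9` for `N ≥ 6` and `u(N) ≥ 12` for `N ≥ 8` (ladder rows `6` and `8`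
move from `[8,14]`, `[10,32]` to `[9,14]`, `[12,32]`).  Reach of the instrument: a three-column triple with `g > 0` has `≤ 9`
rows per slot (`ℓ(λ²) ≤ ℓ(λ⁰')ℓ(λ¹') ≤ 9`), so `d ≤ 27`, `N ≤ 9`, `m ≤ 12`; with `k` columns the involution needs `k` odd and
`d ≥ (k−1)m + 2`, slope `k/(k−1) < 3/2` for `k ≥ 5` — like the hook band (BI 2013) and the Koszul flattenings (K15) the law
stops at the `3N/2` wall.  For `n = 3` it gives only `m ≤ 3` although `(3,3,3)³ ∉ S(⟨4⟩)` (Strassen's degree-`9` equation):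
the counting step is not sharp.

All theorems, no `def`, no `sorry`, standard axioms (`decide +kernel` only on the two closed class sums).  Nothing here proves `ω = 2`
or decides `P_O`; the cells calibrate the universal-occurrence threshold `u(N)` whose growth rate `P_O` is about.

References: P. Bürgisser, C. Ikenmeyer, STOC 2011 / arXiv:1011.1350 [key BurgisserIkenmeyer2011], §3.1–3.2, Lemma 3.2, Lemma 6.1;
P. Bürgisser, C. Ikenmeyer, *Fundamental invariants of orbit closures*, J. Algebra 477 (2017) / arXiv:1511.02927 [key BurgisserIkenmeyer2017],
Prop. 5.22; A. Amanov, D. Yeliussizov, IMRN 2023 / arXiv:2202.11059 [key AmanovYeliussizov2022], Lemma 7.11, Cor. 7.12, Remark 7.13;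
P. Bürgisser, C. Ikenmeyer, *Explicit lower bounds via geometric complexity theory*, STOC 2013 [key BurgisserIkenmeyer2013], §4;
W. Fulton, J. Harris, GTM 129 [key FultonHarrisGTM129], Exercise 4.51; T. Lickteig, Linear Algebra Appl. 69 (1985) [key Lickteig1985].
-/


noncomputable section

open scoped BigOperators

namespace Summit.MatrixMultiplication.MatrixMultiplication.Theorems.ObstructionCalculus

open Literature.Computability.AlgebraicComplexity (kroneckerPow isotypicSum₁ isotypicSum₂ isotypicSum₃ unitTensor actTensor triad
  exists_pairing_ne_zero_of_isotypicSum₁₂₃_kroneckerPow_ne_zero card_parts_le_of_isotypicSum₁₂₃_kroneckerPow_ne_zero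
  pairing_unitTensor_eq_sum sum_prod_mul_polytabloid_comp_swap sum_prod_mul_polytabloid_eq_zero_of_apply_eq
  sum_prod_mul_sum_smul_polytabloid exists_sum_smul_polytabloid_eq)
open Literature.NumberTheory.DiophantineGeometry (Word wordRep highestWeightSpace Weight StdFilling ydWeight
  ydWeight_youngDiagram fst_lt_of_mem_youngDiagram kroneckerCoeff)
open Literature.RepresentationTheory.FiniteGroups.MNEval (kronSum kroneckerCoeff_pos_iff_kronSum_pos
  kroneckerCoeff_eq_kronSum_div)

/-! ## §4  The support of the expanded pairing: two letters with three column-sorted preimages -/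

/-- **Structure of a non-vanishing term.** Let `T₁, T₂, T₃` be standard tableaux on the positions `[d]` whose
shapes have at most three columns, `A, B, C` matrices of size `r`, and `I : [d] → [r]` a label map whose term
`⟨⊗ a_I, e_{T₁}⟩ ⟨⊗ b_I, e_{T₂}⟩ ⟨⊗ c_I, e_{T₃}⟩` is non-zero.  Then `I` is injective on the columns of each tableau
(`sum_prod_mul_polytabloid_eq_zero_of_apply_eq`), so every letter has `≤ 3` preimages (three columns); as the fibre
sizes sum to `d ≥ 2r + 2`, at least two letters `x ≠ y` have exactly three preimages — one in each column of each
tableau. [cite: BurgisserIkenmeyer2011, Lemma 6.1 (the mechanism)] -/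
theorem exists_two_tripleLetters_of_term_ne_zero {d r : ℕ} {Y₁ Y₂ Y₃ : YoungDiagram}
    (hN₁ : ∀ c ∈ Y₁.cells, c.1 < r) (hN₂ : ∀ c ∈ Y₂.cells, c.1 < r) (hN₃ : ∀ c ∈ Y₃.cells, c.1 < r)
    (T₁ : StdFilling d Y₁) (T₂ : StdFilling d Y₂) (T₃ : StdFilling d Y₃)
    (hT₁ : ∀ p, (T₁.1 p).2 < 3) (hT₂ : ∀ p, (T₂.1 p).2 < 3) (hT₃ : ∀ p, (T₃.1 p).2 < 3)
    (hdr : 2 * r + 2 ≤ d) (A B C : Matrix (Fin r) (Fin r) ℂ) (I : Fin d → Fin r)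
    (h : (∑ u : Word r d, (∏ m, A (u m) (I m)) * T₁.polytabloid ℂ hN₁ u) *
        (∑ v : Word r d, (∏ m, B (v m) (I m)) * T₂.polytabloid ℂ hN₂ v) *
        (∑ w : Word r d, (∏ m, C (w m) (I m)) * T₃.polytabloid ℂ hN₃ w) ≠ 0) :
    ∃ x y : Fin r, x ≠ y ∧
      ((∃ p₀ p₁ p₂ : Fin d, (∀ m, I m = x ↔ (m = p₀ ∨ m = p₁ ∨ m = p₂)) ∧
          (T₁.1 p₀).2 = 0 ∧ (T₁.1 p₁).2 = 1 ∧ (T₁.1 p₂).2 = 2) ∧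
        (∃ p₀ p₁ p₂ : Fin d, (∀ m, I m = x ↔ (m = p₀ ∨ m = p₁ ∨ m = p₂)) ∧
          (T₂.1 p₀).2 = 0 ∧ (T₂.1 p₁).2 = 1 ∧ (T₂.1 p₂).2 = 2) ∧
        (∃ p₀ p₁ p₂ : Fin d, (∀ m, I m = x ↔ (m = p₀ ∨ m = p₁ ∨ m = p₂)) ∧
          (T₃.1 p₀).2 = 0 ∧ (T₃.1 p₁).2 = 1 ∧ (T₃.1 p₂).2 = 2)) ∧
      ((∃ q₀ q₁ q₂ : Fin d, (∀ m, I m = y ↔ (m = q₀ ∨ m = q₁ ∨ m = q₂)) ∧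
          (T₁.1 q₀).2 = 0 ∧ (T₁.1 q₁).2 = 1 ∧ (T₁.1 q₂).2 = 2) ∧
        (∃ q₀ q₁ q₂ : Fin d, (∀ m, I m = y ↔ (m = q₀ ∨ m = q₁ ∨ m = q₂)) ∧
          (T₂.1 q₀).2 = 0 ∧ (T₂.1 q₁).2 = 1 ∧ (T₂.1 q₂).2 = 2) ∧
        (∃ q₀ q₁ q₂ : Fin d, (∀ m, I m = y ↔ (m = q₀ ∨ m = q₁ ∨ m = q₂)) ∧
          (T₃.1 q₀).2 = 0 ∧ (T₃.1 q₁).2 = 1 ∧ (T₃.1 q₂).2 = 2)) := by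
  classical
  obtain ⟨⟨hP₁, hP₂⟩, hP₃⟩ := mul_ne_zero_iff.1 h |>.imp_left (mul_ne_zero_iff.1)
  -- injectivity of `I` on the columns of the three tableaux
  have inj₁ : ∀ p q, p ≠ q → (T₁.1 p).2 = (T₁.1 q).2 → I p ≠ I q := fun p q hpq hc hI =>
    hP₁ (sum_prod_mul_polytabloid_eq_zero_of_apply_eq hN₁ T₁ hpq hc A hI)
  have inj₂ : ∀ p q, p ≠ q → (T₂.1 p).2 = (T₂.1 q).2 → I p ≠ I q := fun p q hpq hc hI =>
    hP₂ (sum_prod_mul_polytabloid_eq_zero_of_apply_eq hN₂ T₂ hpq hc B hI)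
  have inj₃ : ∀ p q, p ≠ q → (T₃.1 p).2 = (T₃.1 q).2 → I p ≠ I q := fun p q hpq hc hI =>
    hP₃ (sum_prod_mul_polytabloid_eq_zero_of_apply_eq hN₃ T₃ hpq hc C hI)
  -- fibres of `I`
  set fib : Fin r → Finset (Fin d) := fun ℓ => Finset.univ.filter fun m => I m = ℓ with hfib_def
  have mem_fib : ∀ {ℓ m}, m ∈ fib ℓ ↔ I m = ℓ := by
    intro ℓ m
    simp [hfib_def]
  -- every letter has at most three preimages (three columns of `T₁`)
  have hle3 : ∀ ℓ, (fib ℓ).card ≤ 3 := by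
    intro ℓ
    by_contra hlt
    obtain ⟨p, hp, q, hq, hpq, hc⟩ := Finset.exists_ne_map_eq_of_card_lt_of_maps_to
      (s := fib ℓ) (t := Finset.range 3) (f := fun p => (T₁.1 p).2)
      (by rw [Finset.card_range]; omega) (fun p _ => Finset.mem_range.2 (hT₁ p))
    exact inj₁ p q hpq hc ((mem_fib.1 hp).trans (mem_fib.1 hq).symm)
  -- at least two letters have exactly three preimages
  set D := Finset.univ.filter fun ℓ : Fin r => (fib ℓ).card = 3 with hD_def
  have hsum : (Finset.univ : Finset (Fin d)).card = ∑ ℓ, (fib ℓ).card :=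
    Finset.card_eq_sum_card_fiberwise fun m _ => Finset.mem_univ (I m)
  have hD2 : 1 < D.card := by
    have hterm : ∀ ℓ, (fib ℓ).card ≤ 2 + (if (fib ℓ).card = 3 then 1 else 0) := by
      intro ℓ
      have := hle3 ℓ
      split_ifs with h3 <;> omega
    have hDcard : D.card = ∑ ℓ, (if (fib ℓ).card = 3 then 1 else 0) := by
      rw [hD_def, Finset.card_filter]
    have hbound : ∑ ℓ : Fin r, (fib ℓ).card ≤ ∑ ℓ : Fin r, (2 + (if (fib ℓ).card = 3 then 1 else 0)) :=
      Finset.sum_le_sum fun ℓ _ => hterm ℓ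
    rw [Finset.sum_add_distrib, ← hsum, ← hDcard, Finset.sum_const, Finset.card_univ, Fintype.card_fin,
      Finset.card_univ, Fintype.card_fin, smul_eq_mul] at hbound
    omega
  obtain ⟨x, hx, y, hy, hxy⟩ := Finset.one_lt_card.1 hD2
  have hx3 : (fib x).card = 3 := (Finset.mem_filter.1 hx).2
  have hy3 : (fib y).card = 3 := (Finset.mem_filter.1 hy).2
  exact ⟨x, y, hxy,
    ⟨exists_colSorted_fibre T₁ hT₁ I inj₁ x hx3, exists_colSorted_fibre T₂ hT₂ I inj₂ x hx3,
      exists_colSorted_fibre T₃ hT₃ I inj₃ x hx3⟩,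
    ⟨exists_colSorted_fibre T₁ hT₁ I inj₁ y hy3, exists_colSorted_fibre T₂ hT₂ I inj₂ y hy3,
      exists_colSorted_fibre T₃ hT₃ I inj₃ y hy3⟩⟩

/-- **Every term sum of the three-column pairing vanishes.** For standard tableaux `T₁, T₂, T₃` on `[d]` with at most
three columns each and `r × r` matrices `A, B, C` with `2r + 2 ≤ d`:
`∑_{I : [d] → [r]} ⟨⊗ a_I, e_{T₁}⟩ ⟨⊗ b_I, e_{T₂}⟩ ⟨⊗ c_I, e_{T₃}⟩ = 0`, by the letter-exchange involution of §3 on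
the support described in `exists_two_tripleLetters_of_term_ne_zero`: exchanging two triple letters is three
same-column transpositions in EACH tableau, sign `(−1)⁹ = −1`. [cite: BurgisserIkenmeyer2011, Lemma 6.1 (the mechanism)] -/
theorem threeCol_tripleSum_eq_zero {d r : ℕ} {Y₁ Y₂ Y₃ : YoungDiagram}
    (hN₁ : ∀ c ∈ Y₁.cells, c.1 < r) (hN₂ : ∀ c ∈ Y₂.cells, c.1 < r) (hN₃ : ∀ c ∈ Y₃.cells, c.1 < r)
    (T₁ : StdFilling d Y₁) (T₂ : StdFilling d Y₂) (T₃ : StdFilling d Y₃)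
    (hT₁ : ∀ p, (T₁.1 p).2 < 3) (hT₂ : ∀ p, (T₂.1 p).2 < 3) (hT₃ : ∀ p, (T₃.1 p).2 < 3)
    (hdr : 2 * r + 2 ≤ d) (A B C : Matrix (Fin r) (Fin r) ℂ) :
    ∑ I : Fin d → Fin r,
      (∑ u : Word r d, (∏ m, A (u m) (I m)) * T₁.polytabloid ℂ hN₁ u) *
        (∑ v : Word r d, (∏ m, B (v m) (I m)) * T₂.polytabloid ℂ hN₂ v) *
        (∑ w : Word r d, (∏ m, C (w m) (I m)) * T₃.polytabloid ℂ hN₃ w) = 0 := by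
  refine sum_eq_zero_of_letterSwap_invol _
    (fun I ℓ =>
      (∃ p₀ p₁ p₂ : Fin d, (∀ m, I m = ℓ ↔ (m = p₀ ∨ m = p₁ ∨ m = p₂)) ∧
          (T₁.1 p₀).2 = 0 ∧ (T₁.1 p₁).2 = 1 ∧ (T₁.1 p₂).2 = 2) ∧
        (∃ p₀ p₁ p₂ : Fin d, (∀ m, I m = ℓ ↔ (m = p₀ ∨ m = p₁ ∨ m = p₂)) ∧
          (T₂.1 p₀).2 = 0 ∧ (T₂.1 p₁).2 = 1 ∧ (T₂.1 p₂).2 = 2) ∧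
        (∃ p₀ p₁ p₂ : Fin d, (∀ m, I m = ℓ ↔ (m = p₀ ∨ m = p₁ ∨ m = p₂)) ∧
          (T₃.1 p₀).2 = 0 ∧ (T₃.1 p₁).2 = 1 ∧ (T₃.1 p₂).2 = 2))
    ?_ ?_ ?_ ?_
  · -- the set of triple letters is invariant under the exchange of two of them
    intro I x y hxy hGx hGy ℓ
    have hswap : ∀ (m : Fin d) (ℓ' : Fin r),
        (⇑(Equiv.swap x y) ∘ I) m = ℓ' ↔ I m = Equiv.swap x y ℓ' := by
      intro m ℓ'
      rw [Function.comp_apply, Equiv.apply_eq_iff_eq_symm_apply, Equiv.symm_swap]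
    simp only [hswap]
    rcases eq_or_ne ℓ x with rfl | hℓx
    · rw [Equiv.swap_apply_left]
      exact ⟨fun _ => hGx, fun _ => hGy⟩
    rcases eq_or_ne ℓ y with rfl | hℓy
    · rw [Equiv.swap_apply_right]
      exact ⟨fun _ => hGy, fun _ => hGx⟩
    rw [Equiv.swap_apply_of_ne_of_ne hℓx hℓy]
  · -- the term changes sign: `(−1)³` in each of the three tableaux
    rintro I x y hxy ⟨hx₁, hx₂, hx₃⟩ ⟨hy₁, hy₂, hy₃⟩
    rw [threeCol_pairing_letterSwap hN₁ T₁ A I hxy hx₁ hy₁, threeCol_pairing_letterSwap hN₂ T₂ B I hxy hx₂ hy₂,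
      threeCol_pairing_letterSwap hN₃ T₃ C I hxy hx₃ hy₃]
    ring
  · -- triple letters are values
    rintro I x ⟨⟨p₀, p₁, p₂, hfx, -⟩, -⟩
    exact ⟨p₀, (hfx p₀).2 (Or.inl rfl)⟩
  · -- the support carries two triple letters
    intro I hI
    exact exists_two_tripleLetters_of_term_ne_zero hN₁ hN₂ hN₃ T₁ T₂ T₃ hT₁ hT₂ hT₃ hdr A B C I hI

/-! ## §5  The three-column law for the unit tensors -/

/-- Four finite sums commute: the outer index moves inside three others. [folklore] -/
theorem sum_comm_four {α β γ δ M : Type*} [Fintype α] [Fintype β] [Fintype γ] [Fintype δ]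
    [AddCommMonoid M] (f : α → β → γ → δ → M) :
    ∑ i, ∑ x, ∑ y, ∑ z, f i x y z = ∑ x, ∑ y, ∑ z, ∑ i, f i x y z := by
  rw [Finset.sum_comm]
  refine Finset.sum_congr rfl fun x _ => ?_
  rw [Finset.sum_comm]
  refine Finset.sum_congr rfl fun y _ => ?_
  exact Finset.sum_comm

/-- **All pairings of `⟨r⟩^{⊗d}` with highest-weight vectors of three-column weights vanish when `d ≥ 2r + 2`.**
For Young diagrams `Y₁, Y₂, Y₃` with `d` cells and at most three columns, `r × r` matrices `A, B, C` and
coefficient vectors `a_j` on the standard tableaux: `⟪((A⊗B⊗C)·⟨r⟩)^{⊗d}, ξ₁ ⊗ ξ₂ ⊗ ξ₃⟫ = 0` for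
`ξ_j = ∑_T a_j(T) e_T`. [cite: BurgisserIkenmeyer2011, Lemma 6.1 (the mechanism), §3.1] -/
theorem pairing_unitTensor_threeCol_eq_zero {d r : ℕ} {Y₁ Y₂ Y₃ : YoungDiagram}
    (hN₁ : ∀ c ∈ Y₁.cells, c.1 < r) (hN₂ : ∀ c ∈ Y₂.cells, c.1 < r) (hN₃ : ∀ c ∈ Y₃.cells, c.1 < r)
    (hY₁ : ∀ c ∈ Y₁.cells, c.2 < 3) (hY₂ : ∀ c ∈ Y₂.cells, c.2 < 3) (hY₃ : ∀ c ∈ Y₃.cells, c.2 < 3)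
    (hdr : 2 * r + 2 ≤ d) (A B C : Matrix (Fin r) (Fin r) ℂ)
    (a₁ : StdFilling d Y₁ → ℂ) (a₂ : StdFilling d Y₂ → ℂ) (a₃ : StdFilling d Y₃ → ℂ) :
    ∑ u, ∑ v, ∑ w, kroneckerPow (actTensor A B C (unitTensor ℂ r)) d u v w *
      triad (∑ T, a₁ T • T.polytabloid ℂ hN₁) (∑ T, a₂ T • T.polytabloid ℂ hN₂)
        (∑ T, a₃ T • T.polytabloid ℂ hN₃) u v w = 0 := by
  have hT₁ : ∀ (T : StdFilling d Y₁) (p), (T.1 p).2 < 3 := fun T p => hY₁ _ ((YoungDiagram.mem_cells _).2 (T.mem p))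
  have hT₂ : ∀ (T : StdFilling d Y₂) (p), (T.1 p).2 < 3 := fun T p => hY₂ _ ((YoungDiagram.mem_cells _).2 (T.mem p))
  have hT₃ : ∀ (T : StdFilling d Y₃) (p), (T.1 p).2 < 3 := fun T p => hY₃ _ ((YoungDiagram.mem_cells _).2 (T.mem p))
  rw [pairing_unitTensor_eq_sum]
  simp only [sum_prod_mul_sum_smul_polytabloid]
  -- abbreviations for the elementary pairings
  set P₁ : (Fin d → Fin r) → StdFilling d Y₁ → ℂ :=
    fun I T => ∑ u : Word r d, (∏ m, A (u m) (I m)) * T.polytabloid ℂ hN₁ u with hP₁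
  set P₂ : (Fin d → Fin r) → StdFilling d Y₂ → ℂ :=
    fun I T => ∑ v : Word r d, (∏ m, B (v m) (I m)) * T.polytabloid ℂ hN₂ v with hP₂
  set P₃ : (Fin d → Fin r) → StdFilling d Y₃ → ℂ :=
    fun I T => ∑ w : Word r d, (∏ m, C (w m) (I m)) * T.polytabloid ℂ hN₃ w with hP₃
  have hexp : ∀ I : Fin d → Fin r,
      (∑ T, a₁ T * P₁ I T) * (∑ T, a₂ T * P₂ I T) * (∑ T, a₃ T * P₃ I T) =
        ∑ T₁, ∑ T₂, ∑ T₃, (a₁ T₁ * a₂ T₂ * a₃ T₃) * (P₁ I T₁ * P₂ I T₂ * P₃ I T₃) := by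
    intro I
    rw [Finset.sum_mul_sum, Finset.sum_mul]
    refine Finset.sum_congr rfl fun T₁ _ => ?_
    rw [Finset.sum_mul]
    refine Finset.sum_congr rfl fun T₂ _ => ?_
    rw [Finset.mul_sum]
    refine Finset.sum_congr rfl fun T₃ _ => ?_
    ring
  change ∑ I, (∑ T, a₁ T * P₁ I T) * (∑ T, a₂ T * P₂ I T) * (∑ T, a₃ T * P₃ I T) = 0
  rw [Finset.sum_congr rfl fun I _ => hexp I, sum_comm_four]
  refine Finset.sum_eq_zero fun T₁ _ => Finset.sum_eq_zero fun T₂ _ =>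
    Finset.sum_eq_zero fun T₃ _ => ?_
  rw [← Finset.mul_sum, hP₁, hP₂, hP₃,
    threeCol_tripleSum_eq_zero hN₁ hN₂ hN₃ T₁ T₂ T₃ (hT₁ T₁) (hT₂ T₂) (hT₃ T₃) hdr A B C, mul_zero]

/-- A cell of the Young diagram of a partition with all parts `≤ 3` lies in one of the columns `0, 1, 2`. [folklore] -/
theorem snd_lt_three_of_mem_youngDiagram {d : ℕ} (μ : Nat.Partition d) (h3 : ∀ a ∈ μ.parts, a ≤ 3) {c : ℕ × ℕ}
    (hc : c ∈ μ.youngDiagram.cells) : c.2 < 3 := by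
  obtain ⟨h, h'⟩ := (Nat.Partition.mem_youngDiagram_iff μ c).1 ((YoungDiagram.mem_cells _).1 hc)
  have hmem : μ.sortedParts[c.1] ∈ μ.parts := by
    have : μ.sortedParts[c.1] ∈ μ.sortedParts := List.getElem_mem h
    unfold Nat.Partition.sortedParts at this
    exact (Multiset.mem_sort _).1 this
  exact lt_of_lt_of_le h' (h3 _ hmem)

/-- **The three-column law (universal occurrence obstruction).**  Let `λ = (λ⁰, λ¹, λ²) ⊢ d` be a triple of partitions all of
whose parts are `≤ 3` (Young diagrams with at most three columns).  If `d ≥ 2m + 2`, then `λ` does NOT occur in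
`⟨m⟩^{⊗d}`: the triple isotypic character sum of type `λ` kills the `d`-th Kronecker power of the unit tensor `⟨m⟩` —
i.e. every highest-weight vector of weight `λ` in `ℂ[(ℂᵐ)^{⊗3}]_d` vanishes on the border-rank-`≤ m` tensors.
Proof: occurrence would give a non-vanishing pairing with a translate of a triple of highest-weight vectors
(`exists_pairing_ne_zero_of_isotypicSum₁₂₃_kroneckerPow_ne_zero`), these are combinations of polytabloids
(`exists_sum_smul_polytabloid_eq`), and all such pairings vanish (`pairing_unitTensor_threeCol_eq_zero`): in the
expansion over label maps `I : [d] → [m]` a surviving term has `≤ 3` positions per letter, so (`d ≥ 2m+2`) two letters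
fill one cell of every column of every tableau, and exchanging them reverses the sign.  The case of more than `m` rows is
the trivial one (`card_parts_le_of_isotypicSum₁₂₃_kroneckerPow_ne_zero`).  Rectangular case `λ = ((3ⁿ),(3ⁿ),(3ⁿ))`,
`2m + 2 ≤ 3n`: the degree-`3n` invariants of `ℂⁿ ⊗ ℂⁿ ⊗ ℂⁿ` vanish on `σ_m`. [cite: BurgisserIkenmeyer2011, §3.1, Lemma 6.1 (the mechanism)] -/
theorem isotypicSum_kroneckerPow_unitTensor_eq_zero_of_parts_le_three {d m : ℕ} (lam : Fin 3 → Nat.Partition d)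
    (h3 : ∀ j, ∀ a ∈ (lam j).parts, a ≤ 3) (hdm : 2 * m + 2 ≤ d) :
    isotypicSum₁ (lam 0) (isotypicSum₂ (lam 1) (isotypicSum₃ (lam 2) (kroneckerPow (unitTensor ℂ m) d))) = 0 := by
  by_contra hne
  have hc := card_parts_le_of_isotypicSum₁₂₃_kroneckerPow_ne_zero hne
  simp only [Fintype.card_fin] at hc
  obtain ⟨A, B, C, ξ₁, ξ₂, ξ₃, h₁, h₂, h₃, hP⟩ :=
    exists_pairing_ne_zero_of_isotypicSum₁₂₃_kroneckerPow_ne_zero (lam := lam) hne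
  have hN : ∀ j, ∀ c ∈ (lam j).youngDiagram.cells, c.1 < m := by
    intro j c hcell
    refine fst_lt_of_mem_youngDiagram (lam j) ?_ hcell
    fin_cases j
    · exact hc.1
    · exact hc.2.1
    · exact hc.2.2
  have hd : ∀ j, (lam j).youngDiagram.cells.card = d := fun j => Nat.Partition.card_cells_youngDiagram _
  have h₁' : ξ₁ ∈ highestWeightSpace (wordRep ℂ m d) (Weight.ofPartition m (lam 0)) := h₁
  have h₂' : ξ₂ ∈ highestWeightSpace (wordRep ℂ m d) (Weight.ofPartition m (lam 1)) := h₂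
  have h₃' : ξ₃ ∈ highestWeightSpace (wordRep ℂ m d) (Weight.ofPartition m (lam 2)) := h₃
  rw [← ydWeight_youngDiagram] at h₁' h₂' h₃'
  obtain ⟨a₁, rfl⟩ := exists_sum_smul_polytabloid_eq (hN 0) (hd 0) h₁'
  obtain ⟨a₂, rfl⟩ := exists_sum_smul_polytabloid_eq (hN 1) (hd 1) h₂'
  obtain ⟨a₃, rfl⟩ := exists_sum_smul_polytabloid_eq (hN 2) (hd 2) h₃'
  exact hP (pairing_unitTensor_threeCol_eq_zero (hN 0) (hN 1) (hN 2)
    (fun c hcell => snd_lt_three_of_mem_youngDiagram (lam 0) (h3 0) hcell)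
    (fun c hcell => snd_lt_three_of_mem_youngDiagram (lam 1) (h3 1) hcell)
    (fun c hcell => snd_lt_three_of_mem_youngDiagram (lam 2) (h3 2) hcell) hdm A B C a₁ a₂ a₃)

/-- **The instance at the end of the instrument's range** (`d = 27`, `m ≤ 12`): every highest-weight vector of a three-column type of
degree `27` — among them Bürgisser–Ikenmeyer's fundamental invariant `F₃` of `ℂ⁹ ⊗ ℂ⁹ ⊗ ℂ⁹` (type `((3⁹),(3⁹),(3⁹))`) — vanishes on the
tensors of border rank `≤ 12`, not only at the unit tensor `⟨9⟩` (BI 2017 Prop. 5.22(2): `F₃(⟨9⟩) = 0`).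
[cite: BurgisserIkenmeyer2017, Prop. 5.22] [cite: AmanovYeliussizov2022, Cor. 7.12] -/
theorem isotypicSum_threeCol_twentySeven_unitTensor_eq_zero {m : ℕ} (hm : m ≤ 12) (lam : Fin 3 → Nat.Partition 27)
    (h3 : ∀ j, ∀ a ∈ (lam j).parts, a ≤ 3) :
    isotypicSum₁ (lam 0) (isotypicSum₂ (lam 1) (isotypicSum₃ (lam 2) (kroneckerPow (unitTensor ℂ m) 27))) = 0 :=
  isotypicSum_kroneckerPow_unitTensor_eq_zero_of_parts_le_three lam h3 (by omega)

end Summit.MatrixMultiplication.MatrixMultiplication.Theorems.ObstructionCalculus
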